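import Summits.QuantumFields.BalabanUV.Beta.GAN24.Push3Nest
import Summits.QuantumFields.BalabanUV.Beta.GAN24.Push4Nest
import Summits.QuantumFields.BalabanUV.Beta.BorderedHessianSymmetry

/-!
# `BalabanUV.Beta.GAN24.LayerPushAntisymm` — binder row G-an2-4 / (CONV-C), CT-W route «WC-TL» → «QR-LL» (the OWNER gan24-p1's R11 l.40020 and RULING-preview
# R-gan24p1-g26-1 l.40158), (LAY) support lemma (C), file (B) of two (file (A) = `LayerCommutatorAntisymm`):
# **THE TRANSPOSE OF THE THREE-LEG PUSH EXCHANGES THE KERNEL LEGS; AN ff-ANTISYMMETRIC TABLE PUSHED THROUGH EQUAL (OR SIGN-OPPOSITE) KERNEL LEGS IS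
# ANTISYMMETRIC AGAIN — ZERO TOTAL LIVE CHARGE IS CONSERVED BY THE ONE-STEP TRANSPORT**

NOT IN PRINT; OUR BOOKKEEPING (G-an2-4 formalisation swarm → CRUX TEAM (2), leaf prover `b2b-balaban-gan24-formalise-leaf-03`, gen 59; INTENT 1, journal l.40211 ∕
recut l.40367; names PROVISIONAL).  [folklore] kernel algebra over an5's `TameKernelCalculus.trK`, leaf-01's `Push3.push₃`, leaf-17's `Push4` leg kernels ∕
`Push4NestAux.sandwich_congr_ff` ∕ `Push4Nest.abs_Lk_le`, an2's `BorderedHessianSymmetry.sgnK` BY NAME, and ONE dominated re-association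
(`KernelWard.comp_assoc_of_bound`); generic `d`; 0 `def`, 0 cited facts, 0 `def … : Prop`, 0 sorry.  HONEST FRAMING (cell contract, verbatim): «discharging
`BetaPertH` makes Bałaban's UV stability UNCONDITIONAL — a real constructive-QFT result; it is NOT the continuum limit and NOT the Clay problem.»  HONEST DEPENDENCY
(verbatim): «continuum YM on T⁴ ⇐ BetaPertH ∧ nine spine estimates (0/9 proved); BetaPertH ⇐ (D1) ∧ (D4) ∧ CAP+tail; G-an2-4 gates asym, D1 and NE2/3/4.»

## What
* §1 `trK` through the plumbing (hypothesis-free): `trK (ffRead W) = ffRead (trK W)`, `trK (Lk l) = Rk l`, `trK (Rk r) = Lk r`, `trK (vertexW w S κ′u′) = vertexW w Sᵀ κ′u′`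
  (slotwise `Sᵀ κ u := trK (S κ u)`), `trK (mmRead M G) = mmRead M (trK G)` and **`trK F = −sgnK F ⇒ trK (mmRead M F) = −mmRead M F`** (the `mm`-read turns
  sign-antisymmetry into PLAIN antisymmetry one level up — the OWNER g26's W9 (c)); leg signs `Lk (−l) = −Lk l`, `push₃ (−l) r w S = −push₃ l r w S`; the undressed legs of a
  packed kernel: `trK K = K ⇒ rowM K N = colH K N`, **`trK K = sgnK K ⇒ colH K N = −rowM K N`** (the tree's propagators are `sgnK`-symmetric:
  `BorderedHessianSymmetry.trK_KInv`, `BubbleParity.trK_coDressKBmAt_KInvStep` — asym1 g107 W-1).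
* §2 **`trK_push₃_cross`** (hypothesis-free): `trK (push₃ l r w S κ′u′) = ffRead (Lk r ∘ (vertexW w Sᵀ κ′u′ ∘ Rk l))`; **`sandwich_assoc`** (legs `LegDecay` at blocking `N`,
  rate `m > 0`; middle kernel `BiLoc` at `(N•u′, N•u′)`, rate `> 0`): `Lk l ∘ (V ∘ Rk r) = (Lk l ∘ V) ∘ Rk r`; hence **`trK_push₃`**: for `LocStencil S Cs δ`, `0 < δ`,
  `2δ < m`, `trK (push₃ l r w S κ′u′) = push₃ r l w Sᵀ κ′u′` — THE TRANSPOSE EXCHANGES THE KERNEL LEGS.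
* §3 ff-ANTISYMMETRIC TABLES (`∀ κ u x z κ₁ κ₂, S κ u z x (inl κ₂) (inl κ₁) = −S κ u x z (inl κ₁) (inl κ₂)` — the ff block of file (A)'s plain or `sgnK` branch; the
  push reads no other block, `sandwich_congr_ff`): **`trK (push₃ l r w S κ′u′) = −push₃ r l w S κ′u′`**; with EQUAL kernel legs (p2's (REP) transport `push₃ B B B`)
  **`trK (push₃ l l w S κ′u′) = −push₃ l l w S κ′u′`**, and the same with SIGN-OPPOSITE legs `r = −l`; the undressed instances `push₃ (rowM K N) (colH K N) (colH K N) S`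
  for `trK K = K` and for `trK K = sgnK K` (`Decays K CK m`): antisymmetric — with file (A) §3 the pushed letter again has antisymmetric channel charges, zero total.
DISCHARGES NO ROW: no estimate ((LT-1′)∕(LT-1″) are leaf-01's), no audit value; 0 estimate of Bałaban's; NOTHING of «T2Shape» ∕ «T2Drift» ∕ (hW, hWall) ∕ (C) ∕ (Q-R) ∕
(Q-L) discharged; NEVER «G-an2-4 closed» as (CONV-C); NOT D1, NOT BetaPertH, NOT continuum, NOT Clay.
-/

noncomputable section

namespace Summit.QuantumFields.BalabanUV.Beta.GAN24.LayerPushAntisymm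

open Finset
open scoped BigOperators
open Literature.MathematicalPhysics.QuantumFieldTheory
open Literature.MathematicalPhysics.QuantumFieldTheory.Balaban1983to89
open Literature.MathematicalPhysics.QuantumFieldTheory.Balaban1983to89.Beta
open Literature.MathematicalPhysics.QuantumFieldTheory.Balaban1983to89.B12Sec2to5 (l1 l1_nonneg)
open ExpKernelCalculus (MKer Decays BiLoc comp summable_exp_shift')
open Summit.QuantumFields.BalabanUV.Beta.TameKernelCalculus (trK trK_apply trK_comp trK_trK comp_neg_left comp_neg_right)
open Summit.QuantumFields.BalabanUV.Beta.BorderedHessian (sgnF sgnF_inl sgnF_inr sgnK sgnK_apply)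
open OneStepResolventKernel (Fib LocStencil)
open OneStepKernelFamily (colH)
open BalabanStepJetsSucc (mmRead mmRead_inl_inl mmRead_inr_left mmRead_inr_right)
open KernelWard (comp_assoc_of_bound)
open Summit.QuantumFields.BalabanUV.Beta.GAN24.Push4 (Lk Rk ffRead vertexW vertexW_apply rowM rowM_apply colH_apply' Lk_inl_inl Lk_inl_inr Lk_inr Rk_inl_inl
  Rk_inr_left Rk_inr_right ffRead_inl_inl ffRead_inr_left ffRead_inr_right)
open Summit.QuantumFields.BalabanUV.Beta.GAN24.Push3 (push₃ push₃_def push₃_neg ffRead_smul)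
open Summit.QuantumFields.BalabanUV.Beta.GAN24.Push4Bounds (LegDecay LegDecay.nonneg LegDecay.abs_le biLoc_vertexW_keep legDecay_colH)
open Summit.QuantumFields.BalabanUV.Beta.GAN24.Push4Nest (abs_Lk_le abs_Rk_le_bdd)
open Summit.QuantumFields.BalabanUV.Beta.GAN24.Push4NestAux (sandwich_congr_ff)

variable {d : ℕ}

/-! ## §1 `trK` through the plumbing of the push; leg signs; the undressed legs of a (sign-)symmetric packed kernel -/

section Plumbing

variable (l r w : Fin (d + 1) → (Fin (d + 1) → ℤ) → Fin (d + 1) → (Fin (d + 1) → ℤ) → ℝ)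

/-- [folklore] The ff-corner read commutes with the transpose. -/
theorem trK_ffRead (W : MKer (d + 1) (Fib d)) : trK (ffRead W) = ffRead (trK W) := by
  funext x z a b
  rcases a with α | μ
  · rcases b with β | ν
    · rw [trK_apply, ffRead_inl_inl, ffRead_inl_inl, trK_apply]
    · rw [trK_apply, ffRead_inr_right, ffRead_inr_left]
  · rw [trK_apply, ffRead_inr_left, ffRead_inr_right]

/-- [folklore] The transpose of a LEFT leg kernel is the RIGHT leg kernel of the same family. -/
theorem trK_Lk : trK (Lk l) = Rk l := by
  funext x z a b
  rcases a with κ | μ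
  · rcases b with β | ν
    · rw [trK_apply, Lk_inl_inl, Rk_inl_inl]
    · rw [trK_apply, Rk_inr_right, Lk_inr]
  · rw [trK_apply, Rk_inr_left]
    rcases b with β | ν
    · rw [Lk_inl_inr]
    · rw [Lk_inr]

/-- [folklore] The transpose of a RIGHT leg kernel is the LEFT leg kernel of the same family. -/
theorem trK_Rk : trK (Rk r) = Lk r := by
  have h := congrArg trK (trK_Lk r)
  rw [trK_trK] at h
  exact h.symm

/-- [folklore] **`trK` PASSES THROUGH THE TABLE LEG**: `trK (vertexW w S κ′u′) = vertexW w Sᵀ κ′u′` with `Sᵀ κ u := trK (S κ u)` (termwise). -/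
theorem trK_vertexW (S : Fin (d + 1) → (Fin (d + 1) → ℤ) → MKer (d + 1) (Fib d)) (κ' : Fin (d + 1)) (u' : Fin (d + 1) → ℤ) :
    trK (vertexW w S κ' u') = vertexW w (fun κ u => trK (S κ u)) κ' u' := by
  funext x z a b
  rw [trK_apply, vertexW_apply, vertexW_apply]
  rfl

/-- [folklore] The `mm`-read commutes with the transpose. -/
theorem trK_mmRead (M : ℕ) (G : MKer (d + 1) (Fib d)) : trK (mmRead M G) = mmRead M (trK G) := by
  funext x z a b
  rcases a with α | μ
  · rcases b with β | ν
    · rw [trK_apply, mmRead_inl_inl, mmRead_inl_inl, trK_apply]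
    · rw [trK_apply, mmRead_inr_right, mmRead_inr_left]
  · rw [trK_apply, mmRead_inr_left, mmRead_inr_right]

/-- [folklore] **THE `mm`-READ TURNS SIGN-ANTISYMMETRY INTO PLAIN ANTISYMMETRY ONE LEVEL UP** (the OWNER g26's W9 (c)): the read places the mm block
(`sgnF = −1` twice) in the ff slot, so `trK F = −sgnK F ⇒ trK (mmRead M F) = −mmRead M F`. -/
theorem trK_mmRead_of_sgnAntisymm {F : MKer (d + 1) (Fib d)} (hF : trK F = -sgnK F) (M : ℕ) : trK (mmRead M F) = -mmRead M F := by
  rw [trK_mmRead, hF]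
  funext x z a b
  simp only [Pi.neg_apply]
  rcases a with α | μ
  · rcases b with β | ν
    · rw [mmRead_inl_inl, mmRead_inl_inl]
      simp only [Pi.neg_apply, sgnK_apply, sgnF_inr]
      ring
    · rw [mmRead_inr_right, mmRead_inr_right, neg_zero]
  · rw [mmRead_inr_left, mmRead_inr_left, neg_zero]

/-- [folklore] The left leg kernel is odd in the leg family: `Lk (−l) = −Lk l`. -/
theorem Lk_neg : Lk (-l) = -Lk l := by
  funext x z a b
  simp only [Pi.neg_apply]
  rcases a with κ | μ
  · rcases b with β | ν
    · simp only [Lk_inl_inl, Pi.neg_apply]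
    · simp only [Lk_inl_inr, neg_zero]
  · simp only [Lk_inr, neg_zero]

/-- [folklore] **THE PUSH IS ODD IN THE LEFT KERNEL LEG** (no hypothesis): `push₃ (−l) r w S κ′u′ = −push₃ l r w S κ′u′`. -/
theorem push₃_neg_left (S : Fin (d + 1) → (Fin (d + 1) → ℤ) → MKer (d + 1) (Fib d)) (κ' : Fin (d + 1)) (u' : Fin (d + 1) → ℤ) :
    push₃ (-l) r w S κ' u' = -push₃ l r w S κ' u' := by
  rw [push₃_def, push₃_def, Lk_neg, comp_neg_left, comp_neg_left, ← neg_one_smul ℝ (comp (comp (Lk l) (vertexW w S κ' u')) (Rk r)), ffRead_smul,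
    neg_one_smul]

/-- [folklore] The right leg kernel is odd in the leg family: `Rk (−r) = −Rk r`. -/
theorem Rk_neg : Rk (-r) = -Rk r := by
  rw [← trK_Lk, ← trK_Lk, Lk_neg, TameKernelCalculus.trK_neg]

/-- [folklore] **THE PUSH IS ODD IN THE RIGHT KERNEL LEG** (no hypothesis): `push₃ l (−r) w S κ′u′ = −push₃ l r w S κ′u′`. -/
theorem push₃_neg_right (S : Fin (d + 1) → (Fin (d + 1) → ℤ) → MKer (d + 1) (Fib d)) (κ' : Fin (d + 1)) (u' : Fin (d + 1) → ℤ) :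
    push₃ l (-r) w S κ' u' = -push₃ l r w S κ' u' := by
  rw [push₃_def, push₃_def, Rk_neg, comp_neg_right, ← neg_one_smul ℝ (comp (comp (Lk l) (vertexW w S κ' u')) (Rk r)), ffRead_smul, neg_one_smul]

/-- [folklore] For a SYMMETRIC packed kernel the mf-row family IS the ℋ-column family: `trK K = K ⇒ rowM K N = colH K N`. -/
theorem rowM_eq_colH_of_symm {K : MKer (d + 1) (Fib d)} (hK : trK K = K) (N : ℕ) : rowM K N = colH K N := by
  funext β z' κ z
  have h := congrFun (congrFun (congrFun (congrFun hK z) ((N : ℤ) • z')) (Sum.inl κ)) (Sum.inr β)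
  rw [trK_apply] at h
  rw [rowM_apply, colH_apply', ← h]

/-- [folklore] **FOR A SIGN-SYMMETRIC PACKED KERNEL THE TWO UNDRESSED KERNEL LEGS DIFFER BY A SIGN**: `trK K = sgnK K ⇒ colH K N = −rowM K N`
(the tree's `KInv`, `KInvStep`, `coDressKBmAt ρ Lc (KInvStep Lc j)`: `sgnF (inl ·) = 1`, `sgnF (inr ·) = −1`). -/
theorem colH_eq_neg_rowM_of_sgnSymm {K : MKer (d + 1) (Fib d)} (hK : trK K = sgnK K) (N : ℕ) : colH K N = -rowM K N := by
  funext β z' κ z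
  have h := congrFun (congrFun (congrFun (congrFun hK ((N : ℤ) • z')) z) (Sum.inr β)) (Sum.inl κ)
  rw [trK_apply, sgnK_apply, sgnF_inr, sgnF_inl] at h
  rw [Pi.neg_apply, Pi.neg_apply, Pi.neg_apply, Pi.neg_apply, rowM_apply, colH_apply', h]
  ring

end Plumbing

/-! ## §2 The transpose of the push exchanges the kernel legs -/

section Transpose

variable (l r w : Fin (d + 1) → (Fin (d + 1) → ℤ) → Fin (d + 1) → (Fin (d + 1) → ℤ) → ℝ)

/-- [folklore] **THE CROSS-ASSOCIATED TRANSPOSE OF THE PUSH (hypothesis-free)**: `trK (push₃ l r w S κ′u′) = ffRead (Lk r ∘ (vertexW w Sᵀ κ′u′ ∘ Rk l))` — the transpose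
exchanges the two kernel legs and transposes the table slotwise; only the bracketing differs from `push₃ r l w Sᵀ κ′u′`. -/
theorem trK_push₃_cross (S : Fin (d + 1) → (Fin (d + 1) → ℤ) → MKer (d + 1) (Fib d)) (κ' : Fin (d + 1)) (u' : Fin (d + 1) → ℤ) :
    trK (push₃ l r w S κ' u') = ffRead (comp (Lk r) (comp (vertexW w (fun κ u => trK (S κ u)) κ' u') (Rk l))) := by
  rw [push₃_def, trK_ffRead, trK_comp, trK_comp, trK_Rk, trK_Lk, trK_vertexW]

variable {l r w}
variable {N : ℕ} {Cl Cr Cw m Cs δ : ℝ}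

/-- [folklore] **ONE DOMINATED RE-ASSOCIATION OF THE SANDWICH**: for kernel legs localised at a positive rate `m` from the `N`-dilated coarse point and a middle kernel
bi-localised at `(N•u′, N•u′)` at a positive rate, `Lk l ∘ (V ∘ Rk r) = (Lk l ∘ V) ∘ Rk r` (`KernelWard.comp_assoc_of_bound`; majorants: the left leg's decay in the
middle-left site, the middle kernel's decay in the middle-right site times the right leg's sup — as in leaf-17's `Push4Nest.sandwich_nest`). -/
theorem sandwich_assoc (hl : LegDecay l N Cl m) (hr : LegDecay r N Cr m) (hm : 0 < m) {V : MKer (d + 1) (Fib d)} {CV δV : ℝ} {u' : Fin (d + 1) → ℤ}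
    (hV : BiLoc V ((N : ℤ) • u') ((N : ℤ) • u') CV δV) (hδV : 0 < δV) :
    comp (Lk l) (comp V (Rk r)) = comp (comp (Lk l) V) (Rk r) := by
  have hCl := hl.nonneg
  have hCr := hr.nonneg
  have hCV : 0 ≤ CV := hV.nonneg (Sum.inl 0)
  have hrb : ∀ β z' κ z, |r β z' κ z| ≤ Cr := fun β z' κ z => hr.abs_le hm.le β z' κ z
  refine comp_assoc_of_bound fun x'' z' a b => ?_
  refine ⟨fun x => Cl * Real.exp (-m * l1 (x - (N : ℤ) • x'')), fun z => CV * Real.exp (-δV * l1 (z - (N : ℤ) • u')) * Cr,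
    (summable_exp_shift' hm _).mul_left Cl, ((summable_exp_shift' hδV _).mul_left CV).mul_right Cr,
    fun x => by positivity, fun z => by positivity, fun x z f g => ?_⟩
  rw [abs_mul, abs_mul]
  have h3 : |V x z f g| ≤ CV * Real.exp (-δV * l1 (z - (N : ℤ) • u')) := by
    refine (hV x z f g).trans (mul_le_mul_of_nonneg_left (Real.exp_le_exp.2 ?_) hCV)
    nlinarith [l1_nonneg (x - (N : ℤ) • u'), l1_nonneg (z - (N : ℤ) • u')]
  calc |Lk l x'' x a f| * |V x z f g| * |Rk r z z' g b|
      ≤ (Cl * Real.exp (-m * l1 (x - (N : ℤ) • x''))) * (CV * Real.exp (-δV * l1 (z - (N : ℤ) • u'))) * Cr :=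
        mul_le_mul (mul_le_mul (abs_Lk_le hl x'' x a f) h3 (abs_nonneg _) (by positivity)) (abs_Rk_le_bdd hrb hCr z z' g b)
          (abs_nonneg _) (by positivity)
    _ = _ := by ring

/-- [folklore] `LocStencil` is preserved by the slotwise transpose (the `BiLoc` weight at `(u,u)` is symmetric in the two kernel sites). -/
theorem locStencil_trK {S : Fin (d + 1) → (Fin (d + 1) → ℤ) → MKer (d + 1) (Fib d)} (hS : LocStencil S Cs δ) :
    LocStencil (fun κ u => trK (S κ u)) Cs δ := by
  intro κ u x z a b
  show |trK (S κ u) x z a b| ≤ _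
  rw [trK_apply, add_comm (l1 (x - u))]
  exact hS κ u z x b a

/-- [folklore] **THE TRANSPOSE OF THE PUSH EXCHANGES THE KERNEL LEGS**: for leg families `LegDecay` at blocking `N` with a positive rate `m` and a `LocStencil S Cs δ`
table with `0 < δ`, `2δ < m`: `trK (push₃ l r w S κ′u′) = push₃ r l w Sᵀ κ′u′`, `Sᵀ κ u := trK (S κ u)`. -/
theorem trK_push₃ (hl : LegDecay l N Cl m) (hr : LegDecay r N Cr m) (hw : LegDecay w N Cw m) (hm : 0 < m)
    {S : Fin (d + 1) → (Fin (d + 1) → ℤ) → MKer (d + 1) (Fib d)} (hS : LocStencil S Cs δ) (hδ : 0 < δ) (hδm : 2 * δ < m)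
    (κ' : Fin (d + 1)) (u' : Fin (d + 1) → ℤ) :
    trK (push₃ l r w S κ' u') = push₃ r l w (fun κ u => trK (S κ u)) κ' u' := by
  rw [trK_push₃_cross, push₃_def, sandwich_assoc hr hl hm (biLoc_vertexW_keep hw (locStencil_trK hS) hδ.le hδm κ' u') hδ]

end Transpose

/-! ## §3 ff-antisymmetric tables: the pushed letter is antisymmetric again -/

section Antisymm

variable {l r w : Fin (d + 1) → (Fin (d + 1) → ℤ) → Fin (d + 1) → (Fin (d + 1) → ℤ) → ℝ} {N : ℕ} {Cl Cr Cw m Cs δ : ℝ}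
  {S : Fin (d + 1) → (Fin (d + 1) → ℤ) → MKer (d + 1) (Fib d)}

/-- [folklore] On the ff block the slotwise transpose of an ff-ANTISYMMETRIC family is minus the family — the only block the push reads. -/
theorem vertexW_trK_ff_of_antisymm_ff (hff : ∀ κ u x z κ₁ κ₂, S κ u z x (Sum.inl κ₂) (Sum.inl κ₁) = -S κ u x z (Sum.inl κ₁) (Sum.inl κ₂))
    (w : Fin (d + 1) → (Fin (d + 1) → ℤ) → Fin (d + 1) → (Fin (d + 1) → ℤ) → ℝ) (κ' : Fin (d + 1)) (u' x z : Fin (d + 1) → ℤ) (α β : Fin (d + 1)) :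
    vertexW w (fun κ u => trK (S κ u)) κ' u' x z (Sum.inl α) (Sum.inl β) = vertexW w (fun κ u => -S κ u) κ' u' x z (Sum.inl α) (Sum.inl β) := by
  rw [vertexW_apply, vertexW_apply]
  refine Finset.sum_congr rfl fun κ _ => tsum_congr fun u => ?_
  show w κ' u' κ u * trK (S κ u) x z (Sum.inl α) (Sum.inl β) = w κ' u' κ u * (-S κ u) x z (Sum.inl α) (Sum.inl β)
  rw [trK_apply, hff, Pi.neg_apply, Pi.neg_apply, Pi.neg_apply, Pi.neg_apply]

/-- [folklore] **AN ff-ANTISYMMETRIC TABLE: THE TRANSPOSED PUSH IS MINUS THE PUSH WITH THE KERNEL LEGS EXCHANGED** —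
`trK (push₃ l r w S κ′u′) = −push₃ r l w S κ′u′` (legs `LegDecay` at rate `m > 0`, `LocStencil S Cs δ`, `0 < δ`, `2δ < m`). -/
theorem trK_push₃_of_antisymm_ff (hl : LegDecay l N Cl m) (hr : LegDecay r N Cr m) (hw : LegDecay w N Cw m) (hm : 0 < m)
    (hS : LocStencil S Cs δ) (hδ : 0 < δ) (hδm : 2 * δ < m)
    (hff : ∀ κ u x z κ₁ κ₂, S κ u z x (Sum.inl κ₂) (Sum.inl κ₁) = -S κ u x z (Sum.inl κ₁) (Sum.inl κ₂)) (κ' : Fin (d + 1)) (u' : Fin (d + 1) → ℤ) :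
    trK (push₃ l r w S κ' u') = -push₃ r l w S κ' u' := by
  rw [trK_push₃ hl hr hw hm hS hδ hδm, push₃_def, sandwich_congr_ff (vertexW_trK_ff_of_antisymm_ff hff w κ' u'), ← push₃_def, push₃_neg]

/-- [folklore] **R11's CONSERVATION OF ZERO LIVE CHARGE, KERNEL FORM: WITH EQUAL KERNEL LEGS THE PUSH OF AN ff-ANTISYMMETRIC TABLE IS ANTISYMMETRIC** —
`trK (push₃ l l w S κ′u′) = −push₃ l l w S κ′u′` (p2's (REP) transport `push₃ B B B`).  With file (A) §3 the pushed letter again has antisymmetric channel charges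
and zero total live charge. -/
theorem trK_push₃_eq_neg_of_antisymm_ff (hl : LegDecay l N Cl m) (hw : LegDecay w N Cw m) (hm : 0 < m) (hS : LocStencil S Cs δ) (hδ : 0 < δ)
    (hδm : 2 * δ < m) (hff : ∀ κ u x z κ₁ κ₂, S κ u z x (Sum.inl κ₂) (Sum.inl κ₁) = -S κ u x z (Sum.inl κ₁) (Sum.inl κ₂)) (κ' : Fin (d + 1))
    (u' : Fin (d + 1) → ℤ) : trK (push₃ l l w S κ' u') = -push₃ l l w S κ' u' :=
  trK_push₃_of_antisymm_ff hl hl hw hm hS hδ hδm hff κ' u'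

/-- [folklore] `LegDecay` is preserved by negating the leg family. -/
theorem legDecay_neg (hl : LegDecay l N Cl m) : LegDecay (-l) N Cl m := fun μ y κ u => by
  rw [Pi.neg_apply, Pi.neg_apply, Pi.neg_apply, Pi.neg_apply, abs_neg]; exact hl μ y κ u

/-- [folklore] **… AND WITH SIGN-OPPOSITE KERNEL LEGS** (`r = −l`, the undressed legs of a `sgnK`-symmetric kernel): `trK (push₃ (−l) l w S κ′u′) = −push₃ (−l) l w S κ′u′`. -/
theorem trK_push₃_eq_neg_of_antisymm_ff_negLeg (hl : LegDecay l N Cl m) (hw : LegDecay w N Cw m) (hm : 0 < m) (hS : LocStencil S Cs δ) (hδ : 0 < δ)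
    (hδm : 2 * δ < m) (hff : ∀ κ u x z κ₁ κ₂, S κ u z x (Sum.inl κ₂) (Sum.inl κ₁) = -S κ u x z (Sum.inl κ₁) (Sum.inl κ₂)) (κ' : Fin (d + 1))
    (u' : Fin (d + 1) → ℤ) : trK (push₃ (-l) l w S κ' u') = -push₃ (-l) l w S κ' u' := by
  rw [trK_push₃_of_antisymm_ff (legDecay_neg hl) hl hw hm hS hδ hδm hff, push₃_neg_right, push₃_neg_left, neg_neg]

/-- [folklore] THE UNDRESSED INSTANCE, plain branch: for a symmetric packed kernel `K` decaying at rate `m > 0` (`trK K = K`) and an ff-antisymmetric `LocStencil` table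
(`0 < δ`, `2δ < m`), the undressed push `push₃ (rowM K N) (colH K N) (colH K N) S κ′u′` (= `mmRead N (K ∘ vertexOfK K N S κ′u′ ∘ K)` on ff-valued tables,
`Push3.mmRead_sandwich_vertexOfK_eq_push₃`) is antisymmetric. -/
theorem trK_push₃_undressed_of_symm {K : MKer (d + 1) (Fib d)} {CK : ℝ} (hK : Decays K CK m) (hKs : trK K = K) (hm : 0 < m) (N : ℕ)
    (hS : LocStencil S Cs δ) (hδ : 0 < δ) (hδm : 2 * δ < m)
    (hff : ∀ κ u x z κ₁ κ₂, S κ u z x (Sum.inl κ₂) (Sum.inl κ₁) = -S κ u x z (Sum.inl κ₁) (Sum.inl κ₂)) (κ' : Fin (d + 1)) (u' : Fin (d + 1) → ℤ) :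
    trK (push₃ (rowM K N) (colH K N) (colH K N) S κ' u') = -push₃ (rowM K N) (colH K N) (colH K N) S κ' u' := by
  rw [rowM_eq_colH_of_symm hKs]
  exact trK_push₃_eq_neg_of_antisymm_ff (legDecay_colH hK) (legDecay_colH hK) hm hS hδ hδm hff κ' u'

/-- [folklore] **THE UNDRESSED INSTANCE, sign branch** (the tree's propagators): for a `sgnK`-SYMMETRIC packed kernel `K` (`trK K = sgnK K`) decaying at rate `m > 0` and an
ff-antisymmetric `LocStencil` table (`0 < δ`, `2δ < m`), the undressed push `push₃ (rowM K N) (colH K N) (colH K N) S κ′u′` is antisymmetric (the two kernel legs are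
`−colH` and `colH`). -/
theorem trK_push₃_undressed_of_sgnSymm {K : MKer (d + 1) (Fib d)} {CK : ℝ} (hK : Decays K CK m) (hKs : trK K = sgnK K) (hm : 0 < m) (N : ℕ)
    (hS : LocStencil S Cs δ) (hδ : 0 < δ) (hδm : 2 * δ < m)
    (hff : ∀ κ u x z κ₁ κ₂, S κ u z x (Sum.inl κ₂) (Sum.inl κ₁) = -S κ u x z (Sum.inl κ₁) (Sum.inl κ₂)) (κ' : Fin (d + 1)) (u' : Fin (d + 1) → ℤ) :
    trK (push₃ (rowM K N) (colH K N) (colH K N) S κ' u') = -push₃ (rowM K N) (colH K N) (colH K N) S κ' u' := by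
  have hrow : rowM K N = -colH K N := by rw [colH_eq_neg_rowM_of_sgnSymm hKs, neg_neg]
  rw [hrow]
  exact trK_push₃_eq_neg_of_antisymm_ff_negLeg (legDecay_colH hK) (legDecay_colH hK) hm hS hδ hδm hff κ' u'

end Antisymm

end Summit.QuantumFields.BalabanUV.Beta.GAN24.LayerPushAntisymm

end
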